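import Summits.ResolutionOfSingularities.ResolutionOfSingularities.Theorems.EquisingularLiftEquisingularLiftSectionBlowupFlatExceptionalCharts
import Literature.AlgebraicGeometry.Resolution.AffineBlowupUniversal
import Literature.AlgebraicGeometry.Resolution.RegularBlowup
import Literature.AlgebraicGeometry.Resolution.AlterationsLemma32
import Literature.AlgebraicGeometry.Resolution.BlowupsRelativeCartier
import Mathlib.AlgebraicGeometry.Morphisms.Smooth
import Mathlib.AlgebraicGeometry.Morphisms.ClosedImmersion
import HarnessLib

/-!
# `EquisingularLift`, line `strata-split` — the exceptional divisor of the blow-up of a section is flat over the DVR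

Crux `stmt-ResolutionOfSingularities-15660` = `Theses.EquisingularLift.EquisingularLift`; helper sub-goal G3 of the
registered stub `stub_resolveOnePoint_dimOne` (section blow-up calculus over a DVR). Setting: `O` a discrete
valuation ring, `r : U → Spec O` smooth and separated, `s : Spec O → U` a section (`s ≫ r = 𝟙`), `τ : U' → U` a
blow-up of `U` along the ideal sheaf `ker s` of the closed subscheme `C = s(Spec O) ≅ Spec O` (universal property,
`IsBlowup`). CLAIM (`flat_exceptional_of_isBlowup_section`): the exceptional divisor `E = V(ker s · 𝒪_{U'})` is FLAT
over `Spec O`.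

Proof (Liu, *Algebraic Geometry and Arithmetic Curves*, Thm. 8.1.19 (b): the exceptional divisor of the blow-up of
a regular scheme along a regular centre is the projective bundle `ℙ(C_{Y/X})` over the centre; here chartwise):
`U` is regular (smooth over the regular `Spec O`, EGA IV₄ 17.5.8 (iii)) and `C ≅ Spec O` is regular, so near the
closed point `x₀ = s(𝔪)` — on an affine open `V = D(g) ∋ x₀`, which then contains all of `C` — the ideal of `C` is
generated by a quasi-regular sequence `f₁, …, f_c` (`exists_isQuasiRegular_away_of_isRegularRing`). Over `V` the
blow-up is the affine blow-up `Proj A[It]` (`affineBlowup.isBlowup`, uniqueness), whose exceptional divisor is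
covered by the affine pieces over the charts `D₊(fᵢ t)`, spectra of `(A[It])_{(fᵢt)}/(fᵢ) ≅ (A/I)[T_j : j ≠ i]`
(charts file `…SectionBlowupFlatExceptionalCharts`: `flat_exceptional_of_isBlowup_of_isAffine`) — polynomial rings over `A/I`, which is flat over `O` because
`C = V(ker s) ≅ Spec O`. Flatness is local on the source and `E ⊆ τ⁻¹(V)`.

* `flat_exceptional_of_isBlowup_section` — the registered helper (the affine case is
  `flat_exceptional_of_isBlowup_of_isAffine` of the charts file).
-/

set_option linter.dupNamespace false -- mandated namespace `Summit.<Summit>.<Problem>` of this single-conjunct summit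
set_option linter.overlappingInstances false -- the registered signature carries both [IsDomain O] and [IsDiscreteValuationRing O]

noncomputable section

open CategoryTheory CategoryTheory.Limits AlgebraicGeometry TopologicalSpace Topology
open Literature.AlgebraicGeometry.Resolution HomogeneousLocalization

namespace Summit.ResolutionOfSingularities.ResolutionOfSingularities.Cruxes.EquisingularLift.StrataSplit

/-! ## The registered helper -/

/-- **The exceptional divisor of the blow-up of `U` along a section is flat over `Spec O`.** Let `O` be a discrete
valuation ring, `r : U → Spec O` smooth and separated, `s` a section of `r`, and `τ : U' → U` a blow-up of `U` along
the ideal sheaf `ker s` of `C = s(Spec O)`. Then `E = V(ker s · 𝒪_{U'}) → Spec O` is flat. Proof: `U` is regular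
(smooth over the regular `Spec O`) and `C ≅ Spec O` is regular, so on an affine open `V = D(g)` around the image
`x₀` of the closed point — which contains `C`, every point of `Spec O` specializing to the closed point — the ideal of
`C` is generated by a quasi-regular sequence (`exists_isQuasiRegular_away_of_isRegularRing`); over `V` the blow-up
is the affine blow-up, whose exceptional divisor is chartwise `Spec` of a polynomial ring over `Γ(C ∩ V) `, flat
over `O` (`flat_exceptional_of_isBlowup_of_isAffine`); and `E ⊆ τ⁻¹(V)` (`flat_subschemeι_comp_of_comap`).
[cite: Liu2002, Thm. 8.1.19 (b)] -/
theorem flat_exceptional_of_isBlowup_section : ∀ (O : Type) [CommRing O] [IsDomain O] [IsDiscreteValuationRing O] (U U' : AlgebraicGeometry.Scheme.{0}) (r : U ⟶ AlgebraicGeometry.Spec (.of O)) [AlgebraicGeometry.Smooth r] [AlgebraicGeometry.IsSeparated r] (s : AlgebraicGeometry.Spec (.of O) ⟶ U), CategoryTheory.CategoryStruct.comp s r = CategoryTheory.CategoryStruct.id _ → ∀ (τ : U' ⟶ U), Literature.AlgebraicGeometry.Resolution.IsBlowup τ s.ker → AlgebraicGeometry.Flat (CategoryTheory.CategoryStruct.comp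 (s.ker.comap τ).subschemeι (CategoryTheory.CategoryStruct.comp τ r)) := by
  intro O _ _ _ U U' r _ _ s hs τ hτ
  -- (0) `s` is a closed immersion; `U` is locally Noetherian and regular; `V(ker s) ≅ Spec O` is regular
  -- adapted from Literature.AlgebraicGeometry.Resolution.DeJong1996.IsUnionOfSections.isClosedImmersion_of_comp_eq_id
  haveI : IsClosedImmersion s :=
    haveI : IsClosedImmersion (s ≫ r) := by rw [hs]; infer_instance
    .of_comp s r
  haveI : IsLocallyNoetherian U := LocallyOfFiniteType.isLocallyNoetherian r
  haveI hO : IsRegularRing (CommRingCat.of O) := inferInstanceAs (IsRegularRing O)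
  have hUreg : Scheme.IsRegular U := Scheme.IsRegular.of_smooth r (Scheme.isRegular_Spec (.of O))
  have hZreg : Scheme.IsRegular s.ker.subscheme :=
    Scheme.IsRegular.of_isOpenImmersion (inv s.toImage) (Scheme.isRegular_Spec (.of O))
  have hsupp : (s.ker.support : Set U) = Set.range s := by
    rw [Scheme.Hom.support_ker, s.isClosedEmbedding.isClosed_range.closure_eq]
  -- `V(ker s) → Spec O` is an isomorphism, in particular flat
  haveI hflat0 : Flat (s.ker.subschemeι ≫ r) := by
    have h1 : s.toImage ≫ s.ker.subschemeι ≫ r = 𝟙 _ := by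
      rw [Scheme.Hom.toImage_imageι_assoc]; exact hs
    rw [IsIso.eq_inv_of_hom_inv_id h1]
    infer_instance
  -- (1) an affine open `W ∋ x₀ = s(𝔪)`; `A = Γ(U, W)` and `A/I(W)` are regular rings
  set x₀ : U := s (IsLocalRing.closedPoint O) with hx₀
  obtain ⟨W, hW, hxW, -⟩ := exists_isAffineOpen_mem_and_subset (X := U) (x := x₀) (U := ⊤) (Opens.mem_top _)
  haveI : IsNoetherianRing Γ(U, W) := IsLocallyNoetherian.component_noetherian ⟨W, hW⟩
  haveI : IsRegularRing Γ(U, W) := hUreg.isRegularRing_of_isAffineOpen hW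
  set I : Ideal Γ(U, W) := s.ker.ideal ⟨W, hW⟩ with hI
  haveI : IsRegularRing (Γ(U, W) ⧸ I) := by
    have hreg : Scheme.IsRegular (Spec (s.ker.subschemeCover.X ⟨W, hW⟩)) :=
      Scheme.IsRegular.of_isOpenImmersion (s.ker.subschemeCover.f ⟨W, hW⟩) hZreg
    exact (Scheme.isRegular_Spec_iff (.of (Γ(U, W) ⧸ I))).mp hreg
  have hxs : x₀ ∈ s.ker.support := by
    rw [← SetLike.mem_coe, hsupp]; exact ⟨_, rfl⟩
  -- the prime `𝔭` of `x₀` and `I ⊆ 𝔭`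
  -- adapted from Literature.AlgebraicGeometry.Resolution.IsBlowup.isRegular_of_isRegular_subscheme
  have hmemD : ∀ g : Γ(U, W), x₀ ∈ U.basicOpen g ↔ g ∉ (hW.primeIdealOf ⟨x₀, hxW⟩).asIdeal := by
    intro g
    rw [← PrimeSpectrum.mem_basicOpen, ← hW.fromSpec_preimage_basicOpen g]
    change _ ↔ hW.fromSpec (hW.primeIdealOf ⟨x₀, hxW⟩) ∈ U.basicOpen g
    rw [hW.fromSpec_primeIdealOf ⟨x₀, hxW⟩]
  have hIp : I ≤ (hW.primeIdealOf ⟨x₀, hxW⟩).asIdeal := by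
    intro f hf
    have hz := (Scheme.IdealSheafData.mem_support_iff_of_mem (I := s.ker) (U := ⟨W, hW⟩) hxW).mp hxs
    rw [Scheme.mem_zeroLocus_iff] at hz
    by_contra hfp
    exact hz f hf ((hmemD f).mpr hfp)
  -- (2) the local structure theorem: on a basic open `D(g) ∋ x₀` the centre is cut out by a quasi-regular sequence
  obtain ⟨g, hgp, c, f, -, hloc⟩ := exists_isQuasiRegular_away_of_isRegularRing I _ hIp
  have hxg : x₀ ∈ U.basicOpen g := (hmemD g).mpr hgp
  set V : U.Opens := U.basicOpen g with hV
  have hVaff : IsAffineOpen V := hW.basicOpen g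
  haveI : IsAffine (V : Scheme.{0}) := hVaff
  -- `Γ(V, ⊤) = Γ(U, V.ι '' ⊤)` as a `Γ(U, W)`-algebra: a localisation away from `g`
  have hle : V.ι ''ᵁ ⊤ ≤ W := by rw [Scheme.Opens.ι_image_top]; exact U.basicOpen_le g
  letI alg : Algebra Γ(U, W) Γ((V : Scheme.{0}), ⊤) :=
    (U.presheaf.map (homOfLE hle).op).hom.toAlgebra
  haveI hlocV : IsLocalization.Away g Γ((V : Scheme.{0}), ⊤) := by
    haveI := hW.isLocalization_basicOpen g
    refine IsLocalization.isLocalization_of_algEquiv (Submonoid.powers g)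
      (AlgEquiv.ofRingEquiv (f := V.topIso.symm.commRingCatIsoToRingEquiv) fun a => ?_)
    have hcomp : U.presheaf.map (homOfLE (U.basicOpen_le g)).op ≫ V.topIso.inv =
        U.presheaf.map (homOfLE hle).op := by
      rw [Scheme.Opens.topIso_inv]
      exact ((U.presheaf.map_comp _ _).symm.trans (by rfl))
    exact congrArg (fun φ : Γ(U, W) ⟶ Γ((V : Scheme.{0}), ⊤) => φ.hom a) hcomp
  obtain ⟨hIL, hqr, -, -⟩ := hloc Γ((V : Scheme.{0}), ⊤)
  -- the ideal of `ker s|_V` on the affine scheme `V`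
  have hJV : (s.ker.comap V.ι).ideal ⟨⊤, isAffineOpen_top _⟩ =
      Ideal.span (Set.range (algebraMap Γ(U, W) Γ((V : Scheme.{0}), ⊤) ∘ f)) := by
    rw [← hIL, Scheme.IdealSheafData.ideal_comap_of_isOpenImmersion, Scheme.Opens.ι_appIso,
      Iso.refl_inv]
    have hWV : s.ker.ideal ⟨V.ι ''ᵁ ⊤, (isAffineOpen_top (V : Scheme.{0})).image_of_isOpenImmersion V.ι⟩ =
        I.map (U.presheaf.map (homOfLE hle).op).hom :=
      (s.ker.map_ideal (U := ⟨V.ι ''ᵁ ⊤, _⟩) (V := ⟨W, hW⟩) hle).symm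
    rw [hWV]
    change (I.map _).comap (RingHom.id _) = _
    rw [Ideal.comap_id]
    rfl
  -- (3) `C = s(Spec O) ⊆ V`: every point of `Spec O` specializes to the closed point
  have hsV : Set.range s ⊆ (V : Set U) := by
    rintro _ ⟨t, rfl⟩
    have ht : t ⤳ IsLocalRing.closedPoint O := IsLocalRing.specializes_closedPoint t
    exact (ht.map s.continuous).mem_open V.2 hxg
  have hsuppK : ((s.ker.comap τ).support : Set U') ⊆ Set.range (τ ⁻¹ᵁ V).ι := by
    rw [Scheme.IdealSheafData.support_comap, TopologicalSpace.Closeds.coe_preimage, Scheme.Opens.range_ι,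
      hsupp]
    rintro z ⟨t, ht⟩
    show τ z ∈ V
    rw [← ht]
    exact hsV ⟨t, rfl⟩
  -- (4) `V(ker s) ∩ V → Spec O` is flat, hence `Γ(V, ⊤)/(f)` is a flat `O`-module
  set q : (V : Scheme.{0}) ⟶ Spec (.of O) := V.ι ≫ r with hqdef
  haveI hflatV : Flat ((s.ker.comap V.ι).subschemeι ≫ q) := flat_comap_subschemeι_comp V.ι s.ker r
  have hθflat : ((Ideal.Quotient.mk (Ideal.span (Set.range (algebraMap Γ(U, W) Γ((V : Scheme.{0}), ⊤) ∘ f)))).comp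
      ((Scheme.ΓSpecIso (.of O)).inv ≫ q.appTop).hom).Flat := by
    letI algO : Algebra O Γ((V : Scheme.{0}), ⊤) := ((Scheme.ΓSpecIso (.of O)).inv ≫ q.appTop).hom.toAlgebra
    have hq : (isAffineOpen_top (V : Scheme.{0})).fromSpec ≫ q =
        Spec.map (CommRingCat.ofHom (algebraMap O Γ((V : Scheme.{0}), ⊤))) := by
      rw [IsAffineOpen.fromSpec_top, RingHom.algebraMap_toAlgebra, CommRingCat.ofHom_hom, Iso.inv_comp_eq]
      exact eq_toSpecΓ_SpecMap q
    have hM := moduleFlat_quotient_of_flat_subschemeι (K := s.ker.comap V.ι) q ⟨⊤, isAffineOpen_top _⟩ hq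
    rw [hJV] at hM
    have hM' := RingHom.flat_algebraMap_iff.mpr hM
    have halg : algebraMap O (Γ((V : Scheme.{0}), ⊤) ⧸
        Ideal.span (Set.range (algebraMap Γ(U, W) Γ((V : Scheme.{0}), ⊤) ∘ f))) =
        (Ideal.Quotient.mk _).comp ((Scheme.ΓSpecIso (.of O)).inv ≫ q.appTop).hom :=
      RingHom.ext fun _ => rfl
    rw [halg] at hM'
    exact hM'
  -- (5) the blow-up restricted over `V` is a blow-up of the affine scheme `V`; its exceptional divisor is flat
  have hτV : IsBlowup (τ ∣_ V) (s.ker.comap V.ι) := hτ.restrict V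
  haveI hflatE : Flat (((s.ker.comap V.ι).comap (τ ∣_ V)).subschemeι ≫ (τ ∣_ V) ≫ q) :=
    flat_exceptional_of_isBlowup_of_isAffine _ _ (s.ker.comap V.ι) _ _ hJV hqr _ hτV O q hθflat
  -- (6) transport back to `U'`: `E ⊆ τ⁻¹(V)`
  have hK : (s.ker.comap τ).comap (τ ⁻¹ᵁ V).ι = (s.ker.comap V.ι).comap (τ ∣_ V) := by
    rw [← Scheme.IdealSheafData.comap_comp, ← Scheme.IdealSheafData.comap_comp, morphismRestrict_ι]
  have hm : (τ ⁻¹ᵁ V).ι ≫ τ ≫ r = (τ ∣_ V) ≫ q := by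
    rw [hqdef, ← morphismRestrict_ι_assoc]
  haveI : Flat (((s.ker.comap τ).comap (τ ⁻¹ᵁ V).ι).subschemeι ≫ (τ ⁻¹ᵁ V).ι ≫ τ ≫ r) := by
    rw [hK, hm]; exact hflatE
  exact flat_subschemeι_comp_of_comap (τ ⁻¹ᵁ V).ι (s.ker.comap τ) (τ ≫ r) hsuppK

end Summit.ResolutionOfSingularities.ResolutionOfSingularities.Cruxes.EquisingularLift.StrataSplit

end
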